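import Summits.ResolutionOfSingularities.ResolutionOfSingularities.Theorems.HilbertSamuelEliminationSigmaMaxModificationsCorridor3WLadderMovingRows
import Literature.AlgebraicGeometry.Resolution.HilbertSamuelValues
import Mathlib.Algebra.Module.SpanRankOperations
import HarnessLib

/-!
# [OURS · L1 W4.2] `…Corridor3WLadderMovingCells` — the W-top SUB-CELLS OF RECORD (CHAIN v3.8 RULINGS v3.8-E / v3.8-T,
# typing task T6): the embedding-dimension predicate `QEdim4`, the ∃-stage cells («some stage has `e < ē`» ⊇ the
# (2,3)-stages; «γ-top»), the «hits»-rows, and the PROVED joins of the cells into BOTH registered W-top stubs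
# `Wtop3PointedM` / `Wtop3NonpointedM`

OURS (cell res-hironaka, slot W4.2, crux chain w42; typer res-type-053 on res-L1-w42-plan-1's SEAT TABLE v3.8 ask T6);
NOT statements of the manuscript [Hironaka2017] nor of [CossartJannsenSaito2020]; AI-drafted, weaker than expert review.
New file (nothing landed is edited). Every `theorem` below is PROVED; the open content sits in the `def … : Prop` rows.

## What is typed (vocabulary of `…Corridor3WLadderMovingDefs` / `…MovingRows`: `MaxOriginNoMovingNearChainAtQ p N Q G`,
## origin predicates `Q : ℕ → (ℕ → ℕ) → ∀ X, X → Prop`, stage predicates `G : MarkedStage → Prop`)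

* `QEdim4` (v3.8-E, verbatim): `Module.finrank k(x) (CotangentSpace 𝒪_{X,x}) ≤ 4` — «edim ≤ 4» at the ORIGIN (NOT a
  `ν`-predicate). `Moving.edim s` = the same number at a marked point; `edim_eq_spanFinrank` (= minimal number of
  generators of `𝔪`, Mathlib).
* CHAIN-STABILITY, the PROVED form: `edim_eq_of_hsFun_eq_of_hsPhi_eq` — equal Hilbert–Samuel functions `H^N` AND equal
  shifts `φ^N = N − ψ` give equal embedding dimensions (`H^N(1) = φ^N + edim`, tree `Scheme.hsFun_apply_one`). CAVEAT
  (honest): `H^N_X(x) = H^N_{X'}(x')` ALONE fixes `φ + edim`, not `edim` — along a near chain `edim` is constant exactly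
  when `ψ` (Def. 2.28) is; the ruling's «near ⇒ same HS function ⇒ same edim» therefore needs `ψ`-constancy along the
  chain (true e.g. at closed points of equidimensional stages), which is NOT proved here.
* Stage cells: `IsDirDropStage s` («`e(x_n) < ē(x_n)`», the complement of (F3) at the marked point; it CONTAINS v3.8-T's
  (T-b) «(2,3)-stage» `Is23Stage s` := `e = 2 ∧ ē = 3`), `PDegreeGeFour κ` («`[κ : κ²] ≥ 4`», elementary form),
  `IsGammaTopStage N s` ((T-c) «γ-top» READ as: `ē = 3`, the marked point isolated in the Hilbert–Samuel locus of its
  stage (`Moving.Iso`, so that the canonical centre through it is the point) and `[κ(x_n) : κ(x_n)²] ≥ 4`; the clause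
  `p = 2` is carried by the row, not the stage).
* Rows: `MaxOriginNoMovingNearChainHitsAtQ p N Q G B` («no MOVING `G`-chain from a `Q`-origin that HITS `B` at some
  stage»); PROVED splits `atQ_of_avoids_of_hits` (avoid-`B` row ∧ hits-`B` row ⇒ row), `atQ_of_and_split` (origin sub-cut
  by a further predicate `Q'`), `atQ_mono_origin`.
* **Joins of record**: `wtopAtQ_of_cells` — for ANY origin door `Q₀`: E5 cell (`¬QEdim4`, (T-d)) ∧ dir-drop cell (hits
  `IsDirDropStage`, ⊇ (T-b)) ∧ γ cell (hits `IsGammaTopStage`, avoiding dir-drops, (T-c)) ∧ proper cell (avoids both: every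
  stage `e = ē ≥ 3`, (T-a)) ⇒ `MaxOriginNoMovingNearChainAtQ p 3 Q₀ (3 ≤ ē)`; specialised: **`wtop3PointedM_of_cells`**,
  **`wtop3NonpointedM_of_cells`** (the registered constants of `…MovingDefs`).

References: CJS LNM 2270 Def. 2.26 (`e`, `ē`), Def. 2.28 (`H`, `φ`, `ψ`), p. 103 (F3), Def. 13.3 [CossartJannsenSaito2020];
HOME `L/w42/CHAIN.md` v3.8 §0g RULINGS v3.8-E, v3.8-T (T-1)–(T-4).
-/

noncomputable section

-- plan-1/idea-2 module setting kept (namespace `…Corridor3.Moving` re-enters `…Corridor3`)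
set_option linter.dupNamespace false

open CategoryTheory AlgebraicGeometry TopologicalSpace IsLocalRing
open Summit.ResolutionOfSingularities.ResolutionOfSingularities.Theorems.CampaignW42
open Literature.AlgebraicGeometry.Resolution Literature.RingTheory.HilbertSamuel
open Literature.AlgebraicGeometry.CossartJannsenSaito2020

namespace Summit.ResolutionOfSingularities.ResolutionOfSingularities.Theorems.SigmaMaxModificationsCorridor3.Moving

universe u

open Summit.ResolutionOfSingularities.ResolutionOfSingularities.Theorems.SigmaMaxModificationsCorridor3.Helpers
  (QPointed)

/-! ## §C1. Embedding dimension: the origin predicate `QEdim4` and `edim` at a marked stage -/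

/-- [OURS · L1 W4.2] **`QEdim4`** (RULING v3.8-E, verbatim): the ORIGIN `x ∈ X` has embedding dimension `≤ 4`,
`dim_{k(x)} 𝔪_x/𝔪_x² ≤ 4` (Mathlib `IsLocalRing.CotangentSpace`). Card C′'s scope is `QPointed ∧ QEdim4`; its complement
inside W-top is the sub-cell E5. Not a `ν`-predicate. -/
def QEdim4 : ℕ → (ℕ → ℕ) → ∀ X : Scheme.{u}, X → Prop :=
  fun _ _ X x => Module.finrank (ResidueField (X.presheaf.stalk x)) (CotangentSpace (X.presheaf.stalk x)) ≤ 4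

/-- [OURS] The embedding dimension `dim_{k(x_n)} 𝔪/𝔪²` at the marked point of a stage (cf. `Moving.dirDim`). -/
def edim (s : MarkedStage.{u}) : ℕ :=
  Module.finrank (ResidueField (s.W.presheaf.stalk s.pt)) (CotangentSpace (s.W.presheaf.stalk s.pt))

/-- `edim` is the minimal number of generators of `𝔪_{x_n}` (Mathlib, noetherian local rings). -/
theorem edim_eq_spanFinrank (s : MarkedStage.{u}) :
    edim s = (maximalIdeal (s.W.presheaf.stalk s.pt)).spanFinrank := by
  haveI : IsLocallyNoetherian s.W := s.ln
  exact (IsLocalRing.spanFinrank_maximalIdeal_eq_finrank_cotangentSpace (R := s.W.presheaf.stalk s.pt)).symm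

/-- At the initial stage `QEdim4` reads `edim ≤ 4`. -/
theorem qEdim4_iff_edim_init (N : ℕ) (ν : ℕ → ℕ) (X : Scheme.{u}) [IsLocallyNoetherian X] (x : X) :
    QEdim4 N ν X x ↔ edim (MarkedStage.init X x) ≤ 4 :=
  Iff.rfl

/-- **Chain-stability of `edim`, PROVED form**: equal Hilbert–Samuel functions `H^N` and equal shifts `φ^N` (i.e. equal
`ψ`, CJS Def. 2.28) force equal embedding dimensions, since `H^N(1) = φ^N + emb.dim` (tree `Scheme.hsFun_apply_one`).
CAVEAT: with `H^N` alone only `φ + edim` is determined (module docstring). -/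
theorem spanFinrank_eq_of_hsFun_eq_of_hsPhi_eq {X X' : Scheme.{u}} [IsLocallyNoetherian X] [IsLocallyNoetherian X']
    {N N' : ℕ} {x : X} {x' : X'} (hH : Scheme.hsFun X N x = Scheme.hsFun X' N' x')
    (hφ : Scheme.hsPhi X N x = Scheme.hsPhi X' N' x') :
    (maximalIdeal (X.presheaf.stalk x)).spanFinrank = (maximalIdeal (X'.presheaf.stalk x')).spanFinrank := by
  have h1 := Scheme.hsFun_apply_one X N x
  have h2 := Scheme.hsFun_apply_one X' N' x'
  rw [hH, h2, hφ] at h1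
  omega

/-- The marked-stage form of the chain-stability lemma. -/
theorem edim_eq_of_hsFun_eq_of_hsPhi_eq (s s' : MarkedStage.{u}) {N N' : ℕ}
    (hH : @Scheme.hsFun s.W N s.pt = @Scheme.hsFun s'.W N' s'.pt)
    (hφ : @Scheme.hsPhi s.W N s.pt = @Scheme.hsPhi s'.W N' s'.pt) : edim s = edim s' := by
  haveI : IsLocallyNoetherian s.W := s.ln
  haveI : IsLocallyNoetherian s'.W := s'.ln
  rw [edim_eq_spanFinrank, edim_eq_spanFinrank]
  exact spanFinrank_eq_of_hsFun_eq_of_hsPhi_eq hH hφ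

/-! ## §C2. Stage cells -/

/-- [OURS · L1 W4.2] **«`e(x_n) < ē(x_n)`» at the marked point** — the complement of the printed standing assumption (F3)
«`e_x ≤ 1 ∨ e_x = ē_x`» at a grade-`ē ≥ 2` stage (CJS p. 103); contains v3.8-T (T-b)'s (2,3)-stages. -/
def IsDirDropStage (s : MarkedStage.{u}) : Prop :=
  dirDim s < s.geomDirDim

/-- [OURS · L1 W4.2] (T-b) **«(2,3)-stage»**: `e(x_n) = 2 < ē(x_n) = 3` (imperfect `κ(x_n)` only). -/
def Is23Stage (s : MarkedStage.{u}) : Prop :=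
  dirDim s = 2 ∧ s.geomDirDim = 3

/-- A (2,3)-stage is a dir-drop stage. -/
theorem Is23Stage.isDirDropStage {s : MarkedStage.{u}} (h : Is23Stage s) : IsDirDropStage s := by
  unfold IsDirDropStage
  rw [h.1, h.2]
  norm_num

/-- [OURS] **«`[κ : κ²] ≥ 4`»** for a field `κ` (of characteristic `2` in its use), stated elementarily: `κ` is not of the
form `κ² + κ²·a` for any single `a` (for `p = 2`, `[κ : κ²]` is a power of `2`, and `≤ 2` iff `κ = κ²(a)` for some `a`). -/
def PDegreeGeFour (κ : Type u) [Field κ] : Prop :=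
  ∀ a : κ, ∃ b : κ, ∀ c₀ c₁ : κ, b ≠ c₀ ^ 2 + c₁ ^ 2 * a

/-- [OURS · L1 W4.2] (T-c) **«γ-top» stage** (RULING v3.8-D (3) / v3.8-T (T-c) «a POINT centre at an `ē = 3` chain point
of `p`-rank `≥ 2`»), READ at the marked stage as: `ē(x_n) = 3`, `x_n` ISOLATED in the Hilbert–Samuel locus of its stage
(`Moving.Iso N`, so that the canonical centre through `x_n` is the point `x_n` itself), and `[κ(x_n) : κ(x_n)²] ≥ 4`.
The characteristic clause `p = 2` is carried by the row's prime, not by the stage. Typer's reading; plan-1 may re-cut. -/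
def IsGammaTopStage (N : ℕ) (s : MarkedStage.{u}) : Prop :=
  s.geomDirDim = 3 ∧ Iso N s ∧ PDegreeGeFour (ResidueField (s.W.presheaf.stalk s.pt))

/-! ## §C3. «Hits»-rows and the formal splits -/

/-- [OURS · L1 W4.2] **«No MOVING `G`-chain from a `Q`-origin HITS `B`»**: there is no infinite moving chain of canonical
near steps from a maximal origin satisfying `Q`, with `G` at every stage and `B` at SOME stage (the ∃-stage cells of
RULING v3.8-T; companion of `MaxOriginNoMovingRecurrentNearChainAtQ`, which asks `B` infinitely often). -/
def MaxOriginNoMovingNearChainHitsAtQ (p N : ℕ) (Q : ℕ → (ℕ → ℕ) → ∀ X : Scheme.{u}, X → Prop)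
    (G B : MarkedStage.{u} → Prop) : Prop :=
  ∀ (R : ∀ S : Scheme.{u}, CentreSeq S → Prop), OracleFunctional R → OracleAdmissible R →
  ∀ (ν : ℕ → ℕ) (X : Scheme.{u}) [IsLocallyNoetherian X] (x : X), IsMaximalOrigin p N ν X x → Q N ν X x →
    ¬ ∃ c : ℕ → MarkedStage.{u}, Reaches R N ν (MarkedStage.init X x) (c 0) ∧
      (∀ n, CanonicalNearStep R N ν (c n) (c (n + 1))) ∧ (∀ n, G (c n)) ∧
      (∀ n, ∃ m, n ≤ m ∧ (c m).IsBlownUp R N ν) ∧ ∃ n, B (c n)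

/-- **SPLIT (proved): avoid-`B` row ∧ hits-`B` row ⇒ row** (a chain either hits `B` at some stage or avoids it at all
stages). -/
theorem atQ_of_avoids_of_hits {p N : ℕ} {Q : ℕ → (ℕ → ℕ) → ∀ X : Scheme.{u}, X → Prop}
    {G B : MarkedStage.{u} → Prop} (havoid : MaxOriginNoMovingNearChainAtQ p N Q fun s => G s ∧ ¬ B s)
    (hhits : MaxOriginNoMovingNearChainHitsAtQ p N Q G B) : MaxOriginNoMovingNearChainAtQ p N Q G := by
  intro R hRf hRa ν X _ x hX hq
  rintro ⟨c, h0, hstep, hG, hmov⟩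
  by_cases hB : ∃ n, B (c n)
  · exact hhits R hRf hRa ν X x hX hq ⟨c, h0, hstep, hG, hmov, hB⟩
  · push Not at hB
    exact havoid R hRf hRa ν X x hX hq ⟨c, h0, hstep, fun n => ⟨hG n, hB n⟩, hmov⟩

/-- The converse pieces (proved): a row gives its avoid-row … -/
theorem avoids_of_atQ {p N : ℕ} {Q : ℕ → (ℕ → ℕ) → ∀ X : Scheme.{u}, X → Prop} {G : MarkedStage.{u} → Prop}
    (B : MarkedStage.{u} → Prop) (h : MaxOriginNoMovingNearChainAtQ p N Q G) :
    MaxOriginNoMovingNearChainAtQ p N Q fun s => G s ∧ ¬ B s :=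
  h.mono fun _ hs => hs.1

/-- … and its hits-row. -/
theorem hits_of_atQ {p N : ℕ} {Q : ℕ → (ℕ → ℕ) → ∀ X : Scheme.{u}, X → Prop} {G : MarkedStage.{u} → Prop}
    (B : MarkedStage.{u} → Prop) (h : MaxOriginNoMovingNearChainAtQ p N Q G) :
    MaxOriginNoMovingNearChainHitsAtQ p N Q G B := by
  intro R hRf hRa ν X _ x hX hq
  rintro ⟨c, h0, hstep, hG, hmov, -⟩
  exact h R hRf hRa ν X x hX hq ⟨c, h0, hstep, hG, hmov⟩

/-- **ORIGIN SUB-CUT (proved)**: the `Q ∧ Q'`-half and the `Q ∧ ¬Q'`-half give the `Q`-row. -/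
theorem atQ_of_and_split {p N : ℕ} {Q : ℕ → (ℕ → ℕ) → ∀ X : Scheme.{u}, X → Prop}
    (Q' : ℕ → (ℕ → ℕ) → ∀ X : Scheme.{u}, X → Prop) {G : MarkedStage.{u} → Prop}
    (hQ' : MaxOriginNoMovingNearChainAtQ p N (fun N ν X x => Q N ν X x ∧ Q' N ν X x) G)
    (hnQ' : MaxOriginNoMovingNearChainAtQ p N (fun N ν X x => Q N ν X x ∧ ¬ Q' N ν X x) G) :
    MaxOriginNoMovingNearChainAtQ p N Q G := by
  intro R hRf hRa ν X _ x hX hq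
  by_cases hq' : Q' N ν X x
  · exact hQ' R hRf hRa ν X x hX ⟨hq, hq'⟩
  · exact hnQ' R hRf hRa ν X x hX ⟨hq, hq'⟩

/-- Weakening the origin predicate (proved): a row on `Q`-origins gives the row on `Q'`-origins for `Q' ⇒ Q`. -/
theorem atQ_mono_origin {p N : ℕ} {Q Q' : ℕ → (ℕ → ℕ) → ∀ X : Scheme.{u}, X → Prop} {G : MarkedStage.{u} → Prop}
    (h : MaxOriginNoMovingNearChainAtQ p N Q G) (hQQ' : ∀ N ν (X : Scheme.{u}) (x : X), Q' N ν X x → Q N ν X x) :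
    MaxOriginNoMovingNearChainAtQ p N Q' G :=
  fun R hRf hRa ν X _ x hX hq' => h R hRf hRa ν X x hX (hQQ' N ν X x hq')

/-! ## §C4. The W-top cells and their joins into BOTH registered stubs -/

/-- [OURS · L1 W4.2] (T-d) **E5 cell** behind the door `Q₀`: no moving grade-`ē ≥ 3` chain from a `Q₀`-origin of embedding
dimension `≥ 5` (`¬ QEdim4`). OPEN, NAMED (v3.8-E). -/
def WtopE5CellM (p : ℕ) (Q₀ : ℕ → (ℕ → ℕ) → ∀ X : Scheme.{u}, X → Prop) : Prop :=
  MaxOriginNoMovingNearChainAtQ.{u} p 3 (fun N ν X x => Q₀ N ν X x ∧ ¬ QEdim4 N ν X x) fun s => 3 ≤ s.geomDirDim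

/-- [OURS · L1 W4.2] **dir-drop cell** (⊇ (T-b) «(2,3)-stage») behind the door `Q₀`: no moving grade-`ē ≥ 3` chain from a
`Q₀ ∧ QEdim4`-origin hits a stage with `e(x_n) < ē(x_n)`. -/
def WtopDirDropCellM (p : ℕ) (Q₀ : ℕ → (ℕ → ℕ) → ∀ X : Scheme.{u}, X → Prop) : Prop :=
  MaxOriginNoMovingNearChainHitsAtQ.{u} p 3 (fun N ν X x => Q₀ N ν X x ∧ QEdim4 N ν X x)
    (fun s => 3 ≤ s.geomDirDim) IsDirDropStage

/-- [OURS · L1 W4.2] (T-c) **γ cell** behind the door `Q₀`: no moving grade-`ē ≥ 3` chain from a `Q₀ ∧ QEdim4`-origin,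
with `e = ē` at every stage, hits a γ-top stage. OPEN, NAMED, not staffed (v3.8-T (T-c)). -/
def WtopGammaCellM (p : ℕ) (Q₀ : ℕ → (ℕ → ℕ) → ∀ X : Scheme.{u}, X → Prop) : Prop :=
  MaxOriginNoMovingNearChainHitsAtQ.{u} p 3 (fun N ν X x => Q₀ N ν X x ∧ QEdim4 N ν X x)
    (fun s => 3 ≤ s.geomDirDim ∧ ¬ IsDirDropStage s) (IsGammaTopStage 3)

/-- [OURS · L1 W4.2] (T-a) **proper cell** («E3-proper hypersurface») behind the door `Q₀`: no moving chain from a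
`Q₀ ∧ QEdim4`-origin with, at EVERY stage, `ē ≥ 3`, `e = ē` (no dir-drop) and no γ-top stage — card C′'s territory on the
pointed door, the CORE hunt on the non-pointed door. -/
def WtopProperCellM (p : ℕ) (Q₀ : ℕ → (ℕ → ℕ) → ∀ X : Scheme.{u}, X → Prop) : Prop :=
  MaxOriginNoMovingNearChainAtQ.{u} p 3 (fun N ν X x => Q₀ N ν X x ∧ QEdim4 N ν X x)
    fun s => (3 ≤ s.geomDirDim ∧ ¬ IsDirDropStage s) ∧ ¬ IsGammaTopStage 3 s

/-- **JOIN OF RECORD (proved), for any origin door `Q₀`**: E5 cell ∧ dir-drop cell ∧ γ cell ∧ proper cell ⇒ the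
grade-`ē ≥ 3` moving row behind `Q₀`. -/
theorem wtopAtQ_of_cells {p : ℕ} (Q₀ : ℕ → (ℕ → ℕ) → ∀ X : Scheme.{u}, X → Prop) (hE5 : WtopE5CellM p Q₀)
    (hdrop : WtopDirDropCellM p Q₀) (hγ : WtopGammaCellM p Q₀) (hproper : WtopProperCellM p Q₀) :
    MaxOriginNoMovingNearChainAtQ.{u} p 3 Q₀ fun s => 3 ≤ s.geomDirDim := by
  refine atQ_of_and_split QEdim4 ?_ hE5
  -- behind `Q₀ ∧ QEdim4`: split off the chains hitting a dir-drop stage, then those hitting a γ-top stage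
  refine atQ_of_avoids_of_hits ?_ hdrop
  exact atQ_of_avoids_of_hits hproper hγ

/-- **`Wtop3PointedM` from its four cells (proved)** — the registered stub `stub_Wtop3M_pointed`'s constant, cut per
RULING v3.8-T (T-3) behind the pointed door. -/
theorem wtop3PointedM_of_cells {p : ℕ} (hE5 : WtopE5CellM.{u} p QPointed) (hdrop : WtopDirDropCellM.{u} p QPointed)
    (hγ : WtopGammaCellM.{u} p QPointed) (hproper : WtopProperCellM.{u} p QPointed) : Wtop3PointedM.{u} p :=
  wtopAtQ_of_cells QPointed hE5 hdrop hγ hproper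

/-- **`Wtop3NonpointedM` from its four cells (proved)** — the registered stub `stub_Wtop3M_nonpointed`'s constant (THE
CORE), cut per RULING v3.8-T (T-3) behind the non-pointed door. -/
theorem wtop3NonpointedM_of_cells {p : ℕ} (hE5 : WtopE5CellM.{u} p fun N ν X x => ¬ QPointed N ν X x)
    (hdrop : WtopDirDropCellM.{u} p fun N ν X x => ¬ QPointed N ν X x)
    (hγ : WtopGammaCellM.{u} p fun N ν X x => ¬ QPointed N ν X x)
    (hproper : WtopProperCellM.{u} p fun N ν X x => ¬ QPointed N ν X x) : Wtop3NonpointedM.{u} p :=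
  wtopAtQ_of_cells (fun N ν X x => ¬ QPointed N ν X x) hE5 hdrop hγ hproper

/-- Conversely (proved), each cell is implied by its stub — the cut loses nothing. -/
theorem cells_of_wtopAtQ {p : ℕ} (Q₀ : ℕ → (ℕ → ℕ) → ∀ X : Scheme.{u}, X → Prop)
    (h : MaxOriginNoMovingNearChainAtQ.{u} p 3 Q₀ fun s => 3 ≤ s.geomDirDim) :
    WtopE5CellM p Q₀ ∧ WtopDirDropCellM p Q₀ ∧ WtopGammaCellM p Q₀ ∧ WtopProperCellM p Q₀ := by
  have h4 : MaxOriginNoMovingNearChainAtQ.{u} p 3 (fun N ν X x => Q₀ N ν X x ∧ QEdim4 N ν X x)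
      fun s => 3 ≤ s.geomDirDim := atQ_mono_origin h fun _ _ _ _ hq => hq.1
  refine ⟨atQ_mono_origin h fun _ _ _ _ hq => hq.1, hits_of_atQ _ h4, hits_of_atQ _ (avoids_of_atQ _ h4), ?_⟩
  exact (avoids_of_atQ IsDirDropStage h4).mono fun s hs => hs.1

end Summit.ResolutionOfSingularities.ResolutionOfSingularities.Theorems.SigmaMaxModificationsCorridor3.Moving

end
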